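/-
Copyright (c) 2026. Released under the Apache 2.0 license.
-/
import Literature.NumberTheory.EllipticCurves.SemistabilityDefect
import Literature.NumberTheory.EllipticCurves.PastenHeightBoundsLemma68Proofs
import Literature.NumberTheory.EllipticCurves.ShafarevichGoodReductionBadPlacesProofs
import Literature.NumberTheory.EllipticCurves.IsogenyDualProofs
import Literature.NumberTheory.EllipticCurves.IsogenyGroundFieldExtension
import HarnessLib

/-!
# The semistability defect at `p` is an isogeny invariant — PROOFS

`Proofs` file (theorems only: no definition, no named fact, no instance), topic
`NumberTheory/EllipticCurves`; companion of `SemistabilityDefect.lean` (Kraus 1990's "défaut de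
semi-stabilité" `W.semistabilityDefectAt p`: the least ramification index `e(w ∣ p)` of a place `w`
of a number field at which `W` becomes semistable, `W.IsSemistabilityWitnessAt p e`).

In print the defect is read off the `ℓ`-adic representation: "for `ℓ ≠ p` the Galois
representation `ρ_{E,ℓ}` factors through the quotient `I_K/I_L` … since we chose `L` to be minimal,
it injects into `Aut(T_ℓ(E))`" (Coppola 2020 §2, restating Kraus 1990 / Serre–Tate), and
`V_ℓ(E) ≅ V_ℓ(E')` for isogenous curves, so `L` and `[L : K^{nr}]` are isogeny invariants.  The
tree's definition is by WITNESSES (a number field `F` and a place `w ∋ p` with `e(w ∣ p) = e` and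
`W_F` semistable at `w`), and the invariance is proved here witness by witness from two theorems of
the tree: good reduction at a place of a number field is an isogeny invariant
(`Isogeny.hasGoodReductionAt_of_hasGoodReductionAt`, Silverman *AEC* VII.7.2, via the criterion of
Néron–Ogg–Shafarevich) and so is multiplicative reduction
(`Isogeny.hasMultiplicativeReductionAt_of_hasMultiplicativeReductionAt`, *AEC* VII.7.2 with §C.16:
isogenous curves have the same local factors).

* `Isogeny.isSemistableAt_of_isSemistableAt`, `Isogeny.isSemistableAt_iff` — over any number
  field `K`, a `K`-isogeny preserves semistability (good-or-multiplicative reduction) at every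
  finite place;
* `Isogeny.isSemistabilityWitnessAt_iff` — a `ℚ`-isogeny `W → W'` identifies the semistability
  witnesses of `W` and `W'` at every `p` and every index `e`;
* `Isogeny.semistabilityDefectAt_eq`, `IsIsogenous.semistabilityDefectAt_eq` —
  `W.semistabilityDefectAt p = W'.semistabilityDefectAt p`.

Cell context (nothing below is claimed to be proved here): on the route `TameQuarticManinParity`
(LINE 20, items `TprimeRedNeronUnitForcesKodairaThree` / `TprimeRedKodairaThreeForcesNeronUnit`) the
`3`-isogenous partner `W₂` of a tame-quartic curve `W` (defect `4` at `3`, tree theorem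
`semistabilityDefectAt_eq_four_of_kodairaSymbolAt_eq_III_or_IIIstar`) must again have defect `4`,
whence `12/gcd(12, ord_3 Δ_min(W₂)) ∣ 4` (`twelve_div_gcd_ordMinimalDiscriminant_dvd_semistabilityDefectAt`);
this file supplies the invariance step. BSD is not proved; no leaf, rung or crux is proved here.

## References
* [Coppola2020] N. Coppola, *Wild Galois representations: elliptic curves over a 3-adic field*,
  Acta Arith. 195 (2020), §2 (definition of `L`; `ρ_{E,ℓ}|_{I_K}` factors through `Gal(L/K^{nr})`
  and is faithful on it) — the source of the tree's `semistabilityDefectAt`.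
* [Kraus1990] A. Kraus, Manuscripta Math. 69 (1990) 353–385 (title notion).
* [SilvermanAEC2009] J. H. Silverman, *AEC*, Cor. VII.7.2 (isogenous curves have good reduction
  at the same places), §C.16, Prop. VII.5.4.
-/

noncomputable section

open scoped NumberField

open IsDedekindDomain NumberField

namespace WeierstrassCurve

/-! ## Semistability at a place is an isogeny invariant -/

section NumberFieldPlace

variable {K : Type} [Field K] [NumberField K] {W W' : WeierstrassCurve K} [W.IsElliptic]
  [W'.IsElliptic]

/-- **Semistable reduction at a finite place is preserved along an isogeny** (Silverman *AEC*
Cor. VII.7.2 for the good case; §C.16 / same local factors for the multiplicative case): for a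
`K`-isogeny `φ : W → W'` of elliptic curves over a number field `K` and a finite place `v`, if `W`
is semistable (good or multiplicative) at `v` then so is `W'`. Good reduction is transported back
along the dual isogeny (`Isogeny.exists_dual_of_isElliptic`,
`Isogeny.hasGoodReductionAt_of_hasGoodReductionAt`), multiplicative reduction forward
(`Isogeny.hasMultiplicativeReductionAt_of_hasMultiplicativeReductionAt`).
[cite: SilvermanAEC2009, Cor. VII.7.2 and §C.16] -/
theorem Isogeny.isSemistableAt_of_isSemistableAt (φ : Isogeny W W') {v : HeightOneSpectrum (𝓞 K)}
    (hv : W.IsSemistableAt v) : W'.IsSemistableAt v := by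
  rcases hv with hg | hm
  · obtain ⟨ψ, -⟩ := φ.exists_dual_of_isElliptic
    exact Or.inl (ψ.hasGoodReductionAt_of_hasGoodReductionAt hg)
  · exact Or.inr (φ.hasMultiplicativeReductionAt_of_hasMultiplicativeReductionAt hm)

/-- **Semistability at a finite place is an isogeny invariant** (both directions of
`Isogeny.isSemistableAt_of_isSemistableAt`, the converse through the dual isogeny).
[cite: SilvermanAEC2009, Cor. VII.7.2 and §C.16] -/
theorem Isogeny.isSemistableAt_iff (φ : Isogeny W W') (v : HeightOneSpectrum (𝓞 K)) :
    W.IsSemistableAt v ↔ W'.IsSemistableAt v := by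
  refine ⟨fun h ↦ φ.isSemistableAt_of_isSemistableAt h, fun h ↦ ?_⟩
  obtain ⟨ψ, -⟩ := φ.exists_dual_of_isElliptic
  exact ψ.isSemistableAt_of_isSemistableAt h

end NumberFieldPlace

/-! ## Witnesses and the defect over `ℚ` -/

section Rational

variable {W W' : WeierstrassCurve ℚ} [W.IsElliptic] [W'.IsElliptic]

/-- **A `ℚ`-isogeny transports semistability witnesses** (Kraus 1990 / Coppola 2020 §2: the
minimal semistabilising extension `L` is read off `ρ_{E,ℓ}|_{I_p}`, an isogeny invariant; here
witness by witness): if `(F, w)` is a semistability witness of index `e` at `p` for `W`, it is one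
for `W'`, the base-changed isogeny `φ_F` (`Isogeny.extendScalars`) carrying semistability of `W_F`
at `w` to `W'_F` (`Isogeny.isSemistableAt_of_isSemistableAt`).
[cite: Coppola2020, §2 (definition of L via ρ_{E,ℓ} restricted to inertia; arXiv:1812.05651)]
[cite: SilvermanAEC2009, Cor. VII.7.2 and §C.16] -/
theorem Isogeny.isSemistabilityWitnessAt_of_isSemistabilityWitnessAt (φ : Isogeny W W') {p e : ℕ}
    (h : W.IsSemistabilityWitnessAt p e) : W'.IsSemistabilityWitnessAt p e := by
  obtain ⟨F, hF, hNF, w, hpw, he, hss⟩ := h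
  haveI : (W.baseChange F).IsElliptic := inferInstanceAs (W.map (algebraMap ℚ F)).IsElliptic
  haveI : (W'.baseChange F).IsElliptic := inferInstanceAs (W'.map (algebraMap ℚ F)).IsElliptic
  exact ⟨F, hF, hNF, w, hpw, he, (φ.extendScalars F).isSemistableAt_of_isSemistableAt hss⟩

/-- **The semistability witnesses at `p` of `ℚ`-isogenous elliptic curves coincide** (index by
index; both directions of `Isogeny.isSemistabilityWitnessAt_of_isSemistabilityWitnessAt`, the
converse through the dual isogeny).
[cite: Coppola2020, §2 (L depends only on ρ_{E,ℓ}|_{I_K}; arXiv:1812.05651)]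
[cite: SilvermanAEC2009, Cor. VII.7.2 and §C.16] -/
theorem Isogeny.isSemistabilityWitnessAt_iff (φ : Isogeny W W') (p e : ℕ) :
    W.IsSemistabilityWitnessAt p e ↔ W'.IsSemistabilityWitnessAt p e := by
  refine ⟨fun h ↦ φ.isSemistabilityWitnessAt_of_isSemistabilityWitnessAt h, fun h ↦ ?_⟩
  obtain ⟨ψ, -⟩ := φ.exists_dual_of_isElliptic
  exact ψ.isSemistabilityWitnessAt_of_isSemistabilityWitnessAt h

/-- **The semistability defect at `p` is an isogeny invariant**: for a `ℚ`-isogeny `φ : W → W'` of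
elliptic curves, `W.semistabilityDefectAt p = W'.semistabilityDefectAt p` (Kraus's défaut de
semi-stabilité = `[L : ℚ_p^{nr}]` for the minimal semistabilising `L`, which depends only on the
`ℓ`-adic representation restricted to inertia — Coppola 2020 §2 — hence only on the isogeny class;
in the tree: the two witness sets coincide, `Isogeny.isSemistabilityWitnessAt_iff`, so their infima
do).
[cite: Coppola2020, §2 (definition of L and |Φ_p| = [L : K^{nr}]; arXiv:1812.05651)]
[cite: SilvermanAEC2009, Cor. VII.7.2 and §C.16] -/
theorem Isogeny.semistabilityDefectAt_eq (φ : Isogeny W W') (p : ℕ) :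
    W.semistabilityDefectAt p = W'.semistabilityDefectAt p := by
  rw [semistabilityDefectAt_def, semistabilityDefectAt_def]
  congr 1
  ext e
  exact φ.isSemistabilityWitnessAt_iff p e

/-- **Isogenous elliptic curves over `ℚ` have the same semistability defect at every prime**
(`IsIsogenous` form of `Isogeny.semistabilityDefectAt_eq`).
[cite: Coppola2020, §2 (definition of L; arXiv:1812.05651)]
[cite: SilvermanAEC2009, Cor. VII.7.2 and §C.16] -/
theorem IsIsogenous.semistabilityDefectAt_eq (h : W.IsIsogenous W') (p : ℕ) :
    W.semistabilityDefectAt p = W'.semistabilityDefectAt p := by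
  obtain ⟨φ⟩ := h
  exact φ.semistabilityDefectAt_eq p

/-- **Isogenous elliptic curves over `ℚ` have the same semistability witnesses** (`IsIsogenous`
form of `Isogeny.isSemistabilityWitnessAt_iff`).
[cite: Coppola2020, §2 (definition of L; arXiv:1812.05651)]
[cite: SilvermanAEC2009, Cor. VII.7.2 and §C.16] -/
theorem IsIsogenous.isSemistabilityWitnessAt_iff (h : W.IsIsogenous W') (p e : ℕ) :
    W.IsSemistabilityWitnessAt p e ↔ W'.IsSemistabilityWitnessAt p e := by
  obtain ⟨φ⟩ := h
  exact φ.isSemistabilityWitnessAt_iff p e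

end Rational

end WeierstrassCurve

end
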